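import Summits.BirchSwinnertonDyer.BirchSwinnertonDyer.Theorems.GoldfeldAllTwistsTwoConverseTwinGenusExplicitClassOfPrint
import Literature.NumberTheory.EllipticCurves.HeegnerPointsShimuraReciprocityHoldsProofs
import Literature.NumberTheory.EllipticCurves.HeegnerPointsClassesProofs
import Literature.NumberTheory.EllipticCurves.ModularSymbolsProofs
import HarnessLib

set_option linter.dupNamespace false -- namespace `…BirchSwinnertonDyer.BirchSwinnertonDyer…` is the cell's (D-0017 nested layout)
set_option autoImplicit false

/-!
# Twin″ (item 19140), LINE U, file U2d — the explicit class in KOLYVAGIN currency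

Cell `bsd-goldfeld`, seat `bsd-goldfeld-s1p-c301` (prover, gen 14); ORDER «LINE U» (planner (cliii)/(clvii)); `--supports
stmt-BirchSwinnertonDyer-19140` as a HELPER; memo `HOME/INERT7-UNIT-CIRCLE.md` §3–§4. THE CURRENCY BRIDGE: files U1–U2c speak the SHIMURA
currency (`singularModuliField K ι`, lifts `P_q` indexed by the representatives of a Heegner datum, `θ : Cl ≃* Gal(H_K/K)` of
`heegnerPoints_shimuraReciprocity_holds`), whereas the twin″ index law (files XII–XIV, `…TwinAdditiveGenus*`) and the assembly to come speak
the KOLYVAGIN currency (`K[1] = ringClassField K ι 1`, `𝒢₁ = ringClassGal ι 1 ⊆ Aut(K[1]/ℚ)`, the conductor-one point `y(1)` with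
`x`-coordinate `x₁`, genus sums `Σ s(σ)·σy`). This file restates the explicit-class theorem of U2c in the latter:

* §0 `isSquare_prod_of_involution` — a product over a finite set with a fixed-point-free involution is a square when the pair products
  are; `algEquiv_apply_eq_self_or_eq_neg` — a `K`-automorphism moves `z` with `z² ∈ K` by a sign.
* §1 `isSquare_prod_filter_apply_eq_neg` (Shimura side) — if `τ₀ ∈ Gal(H_K/K)` fixes `j = √−1` and inverts a `w ≠ 0` with `w² ∈ K`
  (so `[τ₀] ∉ Cl²`), the product of `x(P_q) − 2` over the representatives whose class relative to a base `q₁` acts on `j` by `−1` is a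
  square: the index set is a union of `Cl²`-cosets (fibres of `q ↦ [𝔞_q] mod Cl²`), permuted without fixed points by `[τ₀]`, and a pair
  contributes `u·τ₀(u)`, a square by U2c `isSquare_map_mul_map_genusNorm` (with `σ₂ = 1`, `σ₃ = τ₀`).
* §2 `isSquare_prod_filter_fixingSubgroup_of_eq` — the same for a subfield `S = H_K` and `𝒢_S = {σ ∈ Aut(S/ℚ) : σ|ι(K) = id}`, stated
  for a FREE `S` and proved by `subst` (the kernel must never compare the closure-defined fields `ringClassField K ι 1` and
  `singularModuliField K ι`; cf. U2c), identifying `𝒢_S ≃ Gal(H_K/K) ≃ Cl ≃ H.reps` (restriction of scalars; `θ`; representatives based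
  at the representative `q₁` of the conductor-one form, `HeegnerDatum.exists_isGamma0Equiv` + `Γ₀(49)`-invariance of `φ`,
  `φ_gamma0_smul_holds`/`eichlerIntegral_gamma_smul_holds`); HEADLINE **`isSquare_prod_filter_ringClassGal`** (`S := K[1]`,
  `ringClassField_one`): `∏_{σ ∈ 𝒢₁, σ j = −j} (σ x₁ − 2)` is a square in `K[1]`.

Binders: (F-η) `hEta`, (F-D) `hD` by name only (through U2c); `|Dt.c| = 1`. HONEST FRAMING: statements about Heegner points on `X₀(49)`
over the Hilbert class field; nothing about `L`-values, Selmer groups or BSD is claimed; twin″ is not advanced beyond this input.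
References: Gross, *Heegner points on X₀(N)* (1984) §I.1 [Gross1984]; Darmon, *Rational points on modular elliptic curves* (2004)
Thm. 3.7 [Darmon2004]; Lang, *Elliptic Functions* (1987) Ch. 12 §2 (via `hD`) [Lang1987]; Ligozat, Mém. SMF 43 (1975) (via `hEta`) [Ligozat1975].
-/

noncomputable section

open scoped Classical UpperHalfPlane

open Complex NumberField Polynomial
open Literature.NumberTheory.EllipticCurves Literature.NumberTheory.EllipticCurves.ModularForms
open Literature.Computability.Cryptography.Hallgren2005 Literature.Computability.Cryptography.Hallgren2005.OrderCl

namespace Summit.BirchSwinnertonDyer.BirchSwinnertonDyer.Theorems.GoldfeldGoodTwists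

/-! ## §0 Two abstract lemmas -/

/-- A finite product indexed by a set carrying a fixed-point-free involution `φ` is a square as soon as every pair product
`u d · u (φ d)` is. [folklore] -/
theorem isSquare_prod_of_involution {I : Type*} {L : Type*} [CommMonoid L] (u : I → L) (φ : I → I)
    (hφ : ∀ d, φ (φ d) = d) (hfix : ∀ d, φ d ≠ d) (T : Finset I) (hT : ∀ d ∈ T, φ d ∈ T)
    (hpair : ∀ d ∈ T, IsSquare (u d * u (φ d))) : IsSquare (∏ d ∈ T, u d) := by
  induction T using Finset.strongInduction with
  | H T ih =>
    rcases T.eq_empty_or_nonempty with rfl | ⟨d, hd⟩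
    · exact ⟨1, by simp⟩
    · have hsub : ({d, φ d} : Finset I) ⊆ T := by
        intro e he
        rw [Finset.mem_insert, Finset.mem_singleton] at he
        rcases he with rfl | rfl
        exacts [hd, hT _ hd]
      rw [← Finset.prod_sdiff hsub, Finset.prod_pair (hfix d).symm]
      refine IsSquare.mul (ih _ (Finset.sdiff_ssubset hsub ⟨d, by simp⟩) (fun e he ↦ ?_) (fun e he ↦ ?_))
        (hpair d hd)
      · rw [Finset.mem_sdiff] at he ⊢
        refine ⟨hT e he.1, fun hmem ↦ he.2 ?_⟩
        rw [Finset.mem_insert, Finset.mem_singleton] at hmem ⊢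
        rcases hmem with h | h
        · right; rw [← h, hφ]
        · left
          have := congrArg φ h
          rwa [hφ, hφ] at this
      · exact hpair e (Finset.mem_sdiff.mp he).1

/-- An automorphism over `K` moves an element whose square lies in `K` at most by a sign. [folklore] -/
theorem algEquiv_apply_eq_self_or_eq_neg {K F : Type*} [Field K] [Field F] [Algebra K F] (τ : F ≃ₐ[K] F) {z : F}
    (hz : z ^ 2 ∈ Set.range (algebraMap K F)) : τ z = z ∨ τ z = -z := by
  obtain ⟨k, hk⟩ := hz
  have h : (τ z) ^ 2 = z ^ 2 := by rw [← map_pow, ← hk, AlgEquiv.commutes]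
  exact sq_eq_sq_iff_eq_or_eq_neg.mp h

/-! ## §1 The Shimura side: the product of `x(P_q) − 2` over the classes whose automorphism negates `√−1` is a square -/

section Shimura

variable {K : Type} [Field K] [NumberField K]
variable (hK : IsImaginaryQuadratic K) (hH : SatisfiesHeegnerHypothesis 49 K) (ι : K →+* ℂ)
  (H : HeegnerDatum 49 (NumberField.discr K)) (Dt : ModularParametrizationData cm7 49)
  (P : H.reps → (cm7.baseChange (singularModuliField K ι)).toAffine.Point)
  (hP : ∀ q : H.reps, WeierstrassCurve.Affine.Point.map (singularModuliField K ι).subtype.toRatAlgHom (P q) =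
    Dt.φ (heegnerTau q))
  (θ : ClassGroup (OrderCl.QO hK.negDiscr) ≃* (singularModuliField K ι ≃ₐ[K] singularModuliField K ι))
  (hθ : ∀ (γ : ClassGroup (OrderCl.QO hK.negDiscr)) (q : H.reps), ∃ q' : H.reps,
    heegnerFormClass hK q' = γ * heegnerFormClass hK q ∧
    WeierstrassCurve.Affine.Point.map
      (θ γ : singularModuliField K ι →ₐ[K] singularModuliField K ι) (P q) = P q')
  (x y : H.reps → singularModuliField K ι)
  (hxy : ∀ q : H.reps, ∃ h, P q = .some (x q) (y q) h)

include hH hP hθ hxy in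
/-- **The Shimura-side square.** In the setting of U2b/U2c (lifts `P_q` over `H_K` of the Heegner points of a level-`49` datum, Shimura
reciprocity `θ`), granted (F-η) and (F-D): if `τ₀ ∈ Gal(H_K/K)` fixes `j = √−1` but inverts some `w ≠ 0` with `w² ∈ K` (so `τ₀` is not a
square in `Gal(H_K/K)`), then for every base representative `q₁` the product of `x(P_q) − 2` over the representatives `q` whose class
`[𝔞_q][𝔞_{q₁}]⁻¹` acts on `j` by `−1` is a square in `H_K`: the index set is a union of an EVEN number of `Cl²`-cosets, paired by `[τ₀]`,
and each pair contributes `u · τ₀(u)`, a square by U2c. [cite: Gross1984, §I.1] [cite: Lang1987, Ch. 12 §2 Thm. 5] -/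
theorem isSquare_prod_filter_apply_eq_neg (hEta : x049_x_sub_two_eq_etaQuotient)
    (hD : deuring_etaQuotient49_heegner_generates_conjPrime) (hc : |Dt.c| = 1)
    (j : singularModuliField K ι) (hj : j ^ 2 = -1)
    (τ₀ : singularModuliField K ι ≃ₐ[K] singularModuliField K ι) (w : singularModuliField K ι) (hw0 : w ≠ 0)
    (hw2 : w ^ 2 ∈ Set.range (algebraMap K (singularModuliField K ι))) (hτw : τ₀ w = -w) (hτj : τ₀ j = j)
    (q₁ : H.reps) :
    IsSquare (∏ q ∈ Finset.univ.filter
      (fun q : H.reps ↦ θ (heegnerFormClass hK q * (heegnerFormClass hK q₁)⁻¹) j = -j), (x q - 2)) := by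
  haveI : Finite (ClassGroup (OrderCl.QO hK.negDiscr)) :=
    Literature.NumberTheory.ComplexMultiplication.CMTypeLattice.finite_classGroup_QO_of_emod_four hK.negDiscr
      (discr_emod_four_of_heegnerDatum H)
  haveI : Fintype (ClassGroup (OrderCl.QO hK.negDiscr)) := Fintype.ofFinite _
  -- the subgroup of squares of `Cl`, the quotient `Cl/Cl²`, and the class `γ₀` of `τ₀`
  set Sq : Subgroup (ClassGroup (OrderCl.QO hK.negDiscr)) := (powMonoidHom 2).range with hSq_def
  have hmemSq : ∀ δ : ClassGroup (OrderCl.QO hK.negDiscr), δ ^ 2 ∈ Sq := fun δ ↦ ⟨δ, rfl⟩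
  set γ₀ := θ.symm τ₀ with hγ₀_def
  have hθγ₀ : θ γ₀ = τ₀ := θ.apply_symm_apply τ₀
  -- signs on `j`
  have hjK : j ^ 2 ∈ Set.range (algebraMap K (singularModuliField K ι)) := ⟨-1, by rw [hj, map_neg, map_one]⟩
  have hε : ∀ γ, θ γ j = j ∨ θ γ j = -j := fun γ ↦ algEquiv_apply_eq_self_or_eq_neg (θ γ) hjK
  have hεsq : ∀ γ δ, θ (δ ^ 2 * γ) j = θ γ j := by
    intro γ δ
    rw [map_mul, AlgEquiv.mul_apply, sq, map_mul, AlgEquiv.mul_apply]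
    rcases hε γ with h | h
    · rw [h]; rcases hε δ with h' | h' <;> simp [h']
    · rw [h, map_neg]; rcases hε δ with h' | h' <;> simp [h']
  have hεγ₀ : ∀ γ, θ (γ₀ * γ) j = θ γ j := by
    intro γ
    rw [map_mul, AlgEquiv.mul_apply, hθγ₀]
    rcases hε γ with h | h
    · rw [h, hτj]
    · rw [h, map_neg, hτj]
  -- `γ₀ ∉ Cl²` (a square fixes `w`, `τ₀` does not)
  have hγ₀ : γ₀ ∉ Sq := by
    rintro ⟨r, hr⟩
    rw [powMonoidHom_apply] at hr
    have hfix : θ (r ^ 2) w = w := by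
      rw [sq, map_mul, AlgEquiv.mul_apply]
      rcases algEquiv_apply_eq_self_or_eq_neg (θ r) hw2 with h | h
      · rw [h, h]
      · rw [h, map_neg, h, neg_neg]
    rw [hr, hθγ₀, hτw] at hfix
    have h2 : (2 : singularModuliField K ι) * w = 0 := by linear_combination -hfix
    exact hw0 ((mul_eq_zero.mp h2).resolve_left two_ne_zero)
  -- the index set, its fibres over `Cl/Cl²`, the involution `· * [γ₀]`
  set S' := Finset.univ.filter
    (fun q : H.reps ↦ θ (heegnerFormClass hK q * (heegnerFormClass hK q₁)⁻¹) j = -j) with hS'_def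
  set F : H.reps → ClassGroup (OrderCl.QO hK.negDiscr) ⧸ Sq :=
    fun q ↦ QuotientGroup.mk (heegnerFormClass hK q) with hF_def
  set u : ClassGroup (OrderCl.QO hK.negDiscr) ⧸ Sq → singularModuliField K ι :=
    fun d ↦ ∏ q ∈ S'.filter (fun q ↦ F q = d), (x q - 2) with hu_def
  set φ : ClassGroup (OrderCl.QO hK.negDiscr) ⧸ Sq → ClassGroup (OrderCl.QO hK.negDiscr) ⧸ Sq :=
    fun d ↦ d * QuotientGroup.mk γ₀ with hφ_def
  have hprod : ∏ q ∈ S', (x q - 2) = ∏ d ∈ S'.image F, u d :=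
    (Finset.prod_fiberwise_of_maps_to (fun q hq ↦ Finset.mem_image_of_mem F hq) _).symm
  rw [hprod]
  -- representatives of arbitrary classes
  have hrep : ∀ γ : ClassGroup (OrderCl.QO hK.negDiscr), ∃ q : H.reps, heegnerFormClass hK q = γ := fun γ ↦ by
    obtain ⟨R, hR, hRγ⟩ := exists_mem_reps_heegnerFormClass_eq hK hH H γ
    exact ⟨⟨R, hR⟩, hRγ⟩
  -- the fibres of `F` inside `S'` are the `Cl²`-cosets: `u (F q_c) = ∏_{[𝔞_q] ∈ Cl²[𝔞_{q_c}]} (x_q − 2)`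
  have hfib : ∀ qc ∈ S', u (F qc) =
      ∏ q ∈ Finset.univ.filter (fun q : H.reps ↦ ∃ δ, heegnerFormClass hK q = δ ^ 2 * heegnerFormClass hK qc),
        (x q - 2) := by
    intro qc hqc
    rw [hS'_def, Finset.mem_filter] at hqc
    simp only [hu_def]
    congr 1
    ext q
    simp only [hS'_def, Finset.mem_filter, Finset.mem_univ, true_and, hF_def]
    constructor
    · rintro ⟨-, hFq⟩
      rw [QuotientGroup.eq] at hFq
      obtain ⟨r, hr⟩ := hFq
      rw [powMonoidHom_apply, eq_inv_mul_iff_mul_eq] at hr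
      -- `hr : [𝔞_q] · r² = [𝔞_{q_c}]`
      refine ⟨r⁻¹, ?_⟩
      rw [eq_mul_inv_of_mul_eq hr, mul_comm, inv_pow]
    · rintro ⟨δ, hδ⟩
      refine ⟨?_, ?_⟩
      · rw [hδ, mul_assoc, hεsq]; exact hqc.2
      · rw [hδ, QuotientGroup.mk_mul, (QuotientGroup.eq_one_iff _).mpr (hmemSq δ), one_mul]
  -- the involution `φ = (· * [γ₀])` is fixed-point free and preserves the image of `S'`
  have hφinv : ∀ d, φ (φ d) = d := fun d ↦ by
    simp only [hφ_def]
    rw [mul_assoc, ← QuotientGroup.mk_mul, (QuotientGroup.eq_one_iff _).mpr (by rw [← sq]; exact hmemSq γ₀), mul_one]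
  have hfix : ∀ d, φ d ≠ d := fun d h ↦ by
    simp only [hφ_def] at h
    have h1 : (QuotientGroup.mk γ₀ : ClassGroup (OrderCl.QO hK.negDiscr) ⧸ Sq) = 1 :=
      mul_left_cancel (h.trans (mul_one d).symm)
    exact hγ₀ ((QuotientGroup.eq_one_iff γ₀).mp h1)
  -- the `γ₀`-translate of a representative in `S'`
  have htrans : ∀ qc ∈ S', ∃ q' ∈ S', heegnerFormClass hK q' = γ₀ * heegnerFormClass hK qc ∧ F q' = φ (F qc) := by
    intro qc hqc
    obtain ⟨q', hq'⟩ := hrep (γ₀ * heegnerFormClass hK qc)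
    rw [hS'_def, Finset.mem_filter] at hqc
    refine ⟨q', ?_, hq', ?_⟩
    · rw [hS'_def, Finset.mem_filter]
      refine ⟨Finset.mem_univ _, ?_⟩
      rw [hq', mul_assoc, hεγ₀]
      exact hqc.2
    · simp only [hF_def, hφ_def]
      rw [hq', mul_comm, QuotientGroup.mk_mul]
  have hT : ∀ d ∈ S'.image F, φ d ∈ S'.image F := by
    intro d hd
    obtain ⟨qc, hqc, rfl⟩ := Finset.mem_image.mp hd
    obtain ⟨q', hq'S, -, hFq'⟩ := htrans qc hqc
    rw [← hFq']
    exact Finset.mem_image_of_mem F hq'S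
  -- each pair `u(d) · u(φ d) = u · τ₀(u)` is a square by U2c
  have hpair : ∀ d ∈ S'.image F, IsSquare (u d * u (φ d)) := by
    intro d hd
    obtain ⟨qc, hqc, rfl⟩ := Finset.mem_image.mp hd
    obtain ⟨q', hq'S, hq', hFq'⟩ := htrans qc hqc
    rw [← hFq', hfib qc hqc, hfib q' hq'S]
    have hV := map_prod_sqCoset_xCoord hK ι H P θ hθ x y hxy γ₀ (heegnerFormClass hK qc)
    rw [hθγ₀, ← hq'] at hV
    have h := isSquare_map_mul_map_genusNorm hK hH ι H Dt P hP θ hθ x y hxy hEta hD hc 1 τ₀ j hj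
      (by rw [AlgEquiv.one_apply, hτj]) (heegnerFormClass hK qc)
    rw [AlgEquiv.one_apply, hV] at h
    convert h
  exact isSquare_prod_of_involution u φ hφinv hfix _ hT hpair

end Shimura

/-! ## §2 Transfer to the Kolyvagin currency `K[1] = ringClassField K ι 1`, `𝒢 = ringClassGal ι 1` -/

section Transfer

variable {K : Type} [Field K] [NumberField K]

/-- A point of `E` which maps to an affine point is affine, with the expected coordinates. [folklore] -/
theorem exists_eq_some_of_map_eq_some {F L : Type*} [Field F] [Field L] [Algebra ℚ F] [Algebra ℚ L]
    {W : WeierstrassCurve ℚ} (f : F →ₐ[ℚ] L) {Pt : (W.baseChange F).toAffine.Point} {a b : L}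
    {h : (W.baseChange L).toAffine.Nonsingular a b}
    (hmap : WeierstrassCurve.Affine.Point.map f Pt = .some a b h) :
    ∃ xq yq h', Pt = .some xq yq h' ∧ f xq = a ∧ f yq = b := by
  cases Pt with
  | zero =>
    exfalso
    change WeierstrassCurve.Affine.Point.map f 0 = _ at hmap
    rw [map_zero] at hmap
    cases hmap
  | some xq yq h' =>
    rw [WeierstrassCurve.Affine.Point.map_some] at hmap
    obtain ⟨ha, hb⟩ := (WeierstrassCurve.Affine.Point.some.injEq _ _ _ _ _ _).mp hmap
    exact ⟨xq, yq, h', rfl, ha, hb⟩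

/-- **The explicit class, generic-subfield form.** For a subfield `S` of `ℂ` EQUAL to `H_K` (stated for a free `S` so that the kernel never
compares the two closure-defined fields `ringClassField K ι 1` and `singularModuliField K ι`), with `𝒢_S = {σ ∈ Aut(S/ℚ) : σ|ι(K) = id}`:
granted (F-η) and (F-D), if `x₁ ∈ S` is the `x`-coordinate of the conductor-one Heegner point `φ(x(1))` of an optimal level-`49` datum,
`j ∈ S` with `j² = −1`, and some `τ₀ ∈ 𝒢_S` fixes `j` and inverts a `w ≠ 0` with `w² ∈ ι(K)`, then
`∏_{σ ∈ 𝒢_S, σ j = −j} (σ x₁ − 2)` is a square in `S`. Proof: `subst`; identify `𝒢_S` with `Gal(H_K/K)` and, through Shimura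
reciprocity `θ` (`heegnerPoints_shimuraReciprocity_holds`), with the representatives of a Heegner datum based at the representative of
`x(1)` (`HeegnerDatum.exists_isGamma0Equiv`, `φ` is `Γ₀(49)`-invariant); then §1. [cite: Gross1984, §I.1] [cite: Darmon2004, Thm. 3.7] -/
theorem isSquare_prod_filter_fixingSubgroup_of_eq (hEta : x049_x_sub_two_eq_etaQuotient)
    (hD : deuring_etaQuotient49_heegner_generates_conjPrime) (hK : IsImaginaryQuadratic K)
    (hH : SatisfiesHeegnerHypothesis 49 K) (ι : K →+* ℂ) (Dt : ModularParametrizationData cm7 49) (hc : |Dt.c| = 1)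
    {S : Subfield ℂ} (hS : S = singularModuliField K ι)
    [instG : Fintype ↥(fixingSubgroup (S ≃ₐ[ℚ] S) {z : S | (z : ℂ) ∈ Set.range ι})]
    (β : ℤ) (hβ : (4 * (49 : ℕ) : ℤ) ∣ β ^ 2 - NumberField.discr K) (x₁ : S)
    (hx₁ : ∃ yc h, Dt.φ (heegnerPointOfConductor (NumberField.discr K) β 1) = .some (x₁ : ℂ) yc h)
    (j : S) (hj : j ^ 2 = -1) (τ₀ : ↥(fixingSubgroup (S ≃ₐ[ℚ] S) {z : S | (z : ℂ) ∈ Set.range ι}))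
    (w : S) (hw0 : w ≠ 0) (hw2 : ((w : ℂ)) ^ 2 ∈ Set.range ι) (hτw : τ₀.1 w = -w) (hτj : τ₀.1 j = j) :
    IsSquare (∏ σ ∈ Finset.univ.filter
      (fun σ : ↥(fixingSubgroup (S ≃ₐ[ℚ] S) {z : S | (z : ℂ) ∈ Set.range ι}) ↦ σ.1 j = -j), (σ.1 x₁ - 2)) := by
  subst hS
  ------------------------------------------------------------------ the Shimura data
  obtain ⟨H, hHβ⟩ := exists_heegnerDatum 49 hK.discr_neg hβ
  obtain ⟨P, θ, hP, hθ⟩ := heegnerPoints_shimuraReciprocity_holds 49 cm7 K hK hH Dt H ι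
  have hne : ∀ q : H.reps, ∃ xq yq h', P q = .some xq yq h' := by
    intro q
    obtain ⟨yτ, h, hφ⟩ := hEta Dt hc (heegnerTau q)
    have hmap := hP q
    rw [hφ] at hmap
    obtain ⟨xq, yq, h', hq, -, -⟩ := exists_eq_some_of_map_eq_some _ hmap
    exact ⟨xq, yq, h', hq⟩
  choose x y hxy using hne
  ------------------------------------------------------------------ the base representative `q₁` of `x(1)`, `x q₁ = x₁`
  obtain ⟨hQ, hQβ⟩ := heegnerFormOfConductor_mem_heegnerForms (N := 49) hK.discr_neg hβ one_ne_zero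
  rw [Nat.cast_one, one_pow, one_mul] at hQ
  have hQβ' : (heegnerFormOfConductor (NumberField.discr K) β 1).2.1 ≡ H.β [ZMOD 2 * (49 : ℕ)] := by
    rw [hHβ]; rwa [Nat.cast_one, one_mul] at hQβ
  obtain ⟨Q₁, hQ₁, γg, hγg⟩ := H.exists_isGamma0Equiv _ hQ hQβ'
  set q₁ : H.reps := ⟨Q₁, hQ₁⟩ with hq₁_def
  have hφ₁ : Dt.φ (heegnerTau (q₁ : ℤ × ℤ × ℤ)) = Dt.φ (heegnerPointOfConductor (NumberField.discr K) β 1) := by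
    rw [hq₁_def, ← hγg, Dt.φ_gamma0_smul_holds (eichlerIntegral_gamma_smul_holds Dt.f)]
    rfl
  have hxq₁ : x q₁ = x₁ := by
    obtain ⟨yc, h, hsome⟩ := hx₁
    have hmap := hP q₁
    obtain ⟨h₁, hq₁⟩ := hxy q₁
    rw [hφ₁, hsome, hq₁, WeierstrassCurve.Affine.Point.map_some] at hmap
    exact Subtype.ext ((WeierstrassCurve.Affine.Point.some.injEq _ _ _ _ _ _).mp hmap).1
  ------------------------------------------------------------------ `𝒢_S ≃ Gal(H_K/K)` (restriction of scalars, both ways)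
  have hfixK : ∀ σ : ↥(fixingSubgroup (singularModuliField K ι ≃ₐ[ℚ] singularModuliField K ι)
      {z : singularModuliField K ι | (z : ℂ) ∈ Set.range ι}), ∀ k : K, σ.1 (algebraMap K (singularModuliField K ι) k) =
      algebraMap K (singularModuliField K ι) k := fun σ k ↦
    (mem_fixingSubgroup_iff _).mp σ.2 _ ⟨k, (coe_algebraMap_singularModuliField ι k).symm⟩
  have hmemG : ∀ τ : singularModuliField K ι ≃ₐ[K] singularModuliField K ι,
      AlgEquiv.ofRingEquiv (f := τ.toRingEquiv) (R := ℚ)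
        (fun r ↦ by rw [eq_ratCast, AlgEquiv.coe_ringEquiv, map_ratCast]) ∈ (fixingSubgroup (singularModuliField K ι ≃ₐ[ℚ] singularModuliField K ι)
      {z : singularModuliField K ι | (z : ℂ) ∈ Set.range ι}) := by
    intro τ
    rw [mem_fixingSubgroup_iff]
    rintro z ⟨k, hk⟩
    have hz : z = algebraMap K (singularModuliField K ι) k :=
      Subtype.ext (by rw [coe_algebraMap_singularModuliField, hk])
    change τ.toRingEquiv z = z
    rw [hz, AlgEquiv.coe_ringEquiv, AlgEquiv.commutes]
  let e₁ : ↥(fixingSubgroup (singularModuliField K ι ≃ₐ[ℚ] singularModuliField K ι)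
      {z : singularModuliField K ι | (z : ℂ) ∈ Set.range ι}) ≃ (singularModuliField K ι ≃ₐ[K] singularModuliField K ι) :=
    { toFun := fun σ ↦ AlgEquiv.ofRingEquiv (f := (σ.1 : _ ≃ₐ[ℚ] _).toRingEquiv) (hfixK σ)
      invFun := fun τ ↦ ⟨_, hmemG τ⟩
      left_inv := fun σ ↦ by ext z; rfl
      right_inv := fun τ ↦ by ext z; rfl }
  have he₁ : ∀ (σ : ↥(fixingSubgroup (singularModuliField K ι ≃ₐ[ℚ] singularModuliField K ι)
      {z : singularModuliField K ι | (z : ℂ) ∈ Set.range ι})) (z : singularModuliField K ι), e₁ σ z = σ.1 z := fun σ z ↦ rfl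
  ------------------------------------------------------------------ `Cl ≃ H.reps`, based at `q₁`
  have hrep : ∀ γ : ClassGroup (OrderCl.QO hK.negDiscr), ∃ q : H.reps, heegnerFormClass hK q = γ := fun γ ↦ by
    obtain ⟨R, hR, hRγ⟩ := exists_mem_reps_heegnerFormClass_eq hK hH H γ
    exact ⟨⟨R, hR⟩, hRγ⟩
  choose r hr using hrep
  have hbij : Function.Bijective (fun γ : ClassGroup (OrderCl.QO hK.negDiscr) ↦ r (γ * heegnerFormClass hK q₁)) := by
    constructor
    · intro γ γ' h
      have h' := congrArg (fun q : H.reps ↦ heegnerFormClass hK q) h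
      simp only [hr] at h'
      exact mul_right_cancel h'
    · intro q
      refine ⟨heegnerFormClass hK q * (heegnerFormClass hK q₁)⁻¹, heegnerFormClass_injective_reps hK H ?_⟩
      simp only [hr, inv_mul_cancel_right]
  let e₃ : ClassGroup (OrderCl.QO hK.negDiscr) ≃ H.reps := Equiv.ofBijective _ hbij
  have he₃ : ∀ γ, heegnerFormClass hK (e₃ γ) * (heegnerFormClass hK q₁)⁻¹ = γ := fun γ ↦ by
    change heegnerFormClass hK (r (γ * heegnerFormClass hK q₁)) * _ = γ
    rw [hr, mul_inv_cancel_right]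
  let E : ↥(fixingSubgroup (singularModuliField K ι ≃ₐ[ℚ] singularModuliField K ι)
      {z : singularModuliField K ι | (z : ℂ) ∈ Set.range ι}) ≃ H.reps := e₁.trans (θ.symm.toEquiv.trans e₃)
  have hE : ∀ σ : ↥(fixingSubgroup (singularModuliField K ι ≃ₐ[ℚ] singularModuliField K ι)
      {z : singularModuliField K ι | (z : ℂ) ∈ Set.range ι}), θ (heegnerFormClass hK (E σ) * (heegnerFormClass hK q₁)⁻¹) = e₁ σ := fun σ ↦ by
    change θ (heegnerFormClass hK (e₃ (θ.symm (e₁ σ))) * _) = _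
    rw [he₃, MulEquiv.apply_symm_apply]
  have hEx : ∀ σ : ↥(fixingSubgroup (singularModuliField K ι ≃ₐ[ℚ] singularModuliField K ι)
      {z : singularModuliField K ι | (z : ℂ) ∈ Set.range ι}), x (E σ) = σ.1 x₁ := fun σ ↦ by
    obtain ⟨q', hq', hxq'⟩ := exists_apply_xCoord_eq hK ι H P θ hθ x y hxy (θ.symm (e₁ σ)) q₁
    have hEσ : E σ = q' := heegnerFormClass_injective_reps hK H (by
      show heegnerFormClass hK (e₃ (θ.symm (e₁ σ))) = heegnerFormClass hK q'
      rw [hq', mul_inv_eq_iff_eq_mul.mp (he₃ _)])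
    rw [hEσ, ← hxq', MulEquiv.apply_symm_apply, he₁, hxq₁]
  ------------------------------------------------------------------ reindex the product along `E` and apply §1
  have hw2' : w ^ 2 ∈ Set.range (algebraMap K (singularModuliField K ι)) := by
    obtain ⟨k, hk⟩ := hw2
    exact ⟨k, Subtype.ext (by rw [coe_algebraMap_singularModuliField, hk]; rfl)⟩
  have key := isSquare_prod_filter_apply_eq_neg hK hH ι H Dt P hP θ hθ x y hxy hEta hD hc j hj (e₁ τ₀) w hw0 hw2'
    (by rw [he₁]; exact hτw) (by rw [he₁]; exact hτj) q₁
  rw [Finset.prod_equiv E (t := Finset.univ.filter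
      (fun q : H.reps ↦ θ (heegnerFormClass hK q * (heegnerFormClass hK q₁)⁻¹) j = -j)) (g := fun q ↦ x q - 2)]
  · convert key using 0
  · intro σ
    simp only [Finset.mem_filter, Finset.mem_univ, true_and, hE, he₁]
  · intro σ _
    rw [hEx]

/-- **HEADLINE (U2 in Kolyvagin currency).** For `K` imaginary quadratic with the level-`49` Heegner hypothesis, `ι : K → ℂ`,
an optimal datum `Dt` (`|c| = 1`), a residue `β` (`4·49 ∣ β² − d_K`), the `x`-coordinate `x₁ ∈ K[1]` of the conductor-one Heegner point
`φ(x(1))` (as in `KolyvaginHeegnerData.map_y`), `j ∈ K[1]` with `j² = −1`, and some `τ₀ ∈ 𝒢₁ = Gal(K[1]/K)` fixing `j` and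
inverting a `w ≠ 0` with `w² ∈ ι(K)` — granted (F-η) `hEta` and (F-D) `hD`:
**`∏_{σ ∈ 𝒢₁, σ j = −j} (σ x₁ − 2)` is a square in `K[1]`.** Since `x(σ • y) − 2 = σ x₁ − 2` for `y = (x₁, y₁)`, this is the
square class `α_{K[1]}(Σ_{σ j = −j} σ•y) = 1` of the sum of the conjugates of the Heegner point over the classes acting on `√−1`
by `−1` — the input of the second halving on the `7`-inert family `𝒮`. HONEST FRAMING: a statement about Heegner points of `X₀(49)`;
nothing about `L`-values, Selmer groups or BSD is claimed. [cite: Gross1984, §I.1] [cite: Lang1987, Ch. 12 §2 Thm. 5]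
[cite: Darmon2004, Thm. 3.7] -/
theorem isSquare_prod_filter_ringClassGal (hEta : x049_x_sub_two_eq_etaQuotient)
    (hD : deuring_etaQuotient49_heegner_generates_conjPrime) (hK : IsImaginaryQuadratic K)
    (hH : SatisfiesHeegnerHypothesis 49 K) (ι : K →+* ℂ) (Dt : ModularParametrizationData cm7 49) (hc : |Dt.c| = 1)
    [instG : Fintype ↥(ringClassGal ι 1)]
    (β : ℤ) (hβ : (4 * (49 : ℕ) : ℤ) ∣ β ^ 2 - NumberField.discr K) (x₁ : ringClassField K ι 1)
    (hx₁ : ∃ yc h, Dt.φ (heegnerPointOfConductor (NumberField.discr K) β 1) = .some (x₁ : ℂ) yc h)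
    (j : ringClassField K ι 1) (hj : j ^ 2 = -1) (τ₀ : ↥(ringClassGal ι 1))
    (w : ringClassField K ι 1) (hw0 : w ≠ 0) (hw2 : ((w : ℂ)) ^ 2 ∈ Set.range ι) (hτw : τ₀.1 w = -w)
    (hτj : τ₀.1 j = j) :
    IsSquare (∏ σ ∈ Finset.univ.filter (fun σ : ↥(ringClassGal ι 1) ↦ σ.1 j = -j), (σ.1 x₁ - 2)) :=
  isSquare_prod_filter_fixingSubgroup_of_eq (instG := instG) hEta hD hK hH ι Dt hc (ringClassField_one ι) β hβ x₁ hx₁ j hj τ₀ w hw0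
    hw2 hτw hτj

end Transfer

end Summit.BirchSwinnertonDyer.BirchSwinnertonDyer.Theorems.GoldfeldGoodTwists

end
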